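import Mathlib.FieldTheory.IsAlgClosed.AlgebraicClosure
import Mathlib.Analysis.Complex.Polynomial.Basic
import Literature.AlgebraicGeometry.HodgeTheory.AbsoluteHodgeClasses
import Literature.AlgebraicGeometry.HodgeTheory.HodgeConjecture
import HarnessLib

/-!
# Voisin (2007), Prop. 1.2: the Hodge conjecture over `ℚ̄` gives it for (weakly) absolute Hodge classes

Topic `Literature/AlgebraicGeometry/HodgeTheory` (family `hodge`). Two NAMED FACTS, the two readings
("absolute" / "weakly absolute") of

> **Proposition 1.2** (Voisin, *Hodge loci and absolute Hodge classes*, Compositio Math. **143**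
> (2007) 945–958 = arXiv:math/0605766, p. 2, read). *Assume the Hodge conjecture is known for
> varieties `X_ℚ̄` defined over `ℚ̄` and (weakly) absolute Hodge classes `α` on them. Then the
> Hodge conjecture is true for (weakly) absolute Hodge classes.*
> **Remark 1.4.** *In the statement of the Proposition, we fix an embedding of `ℚ̄` into `ℂ` … the
> statement makes sense and is independent of the choice of embedding.*

(answering a question of Maillot–Soulé; proof in §3, p. 6: spread `(X, α)` out to a family
`π : 𝒳 → T` over `ℚ̄` with a flat section `α̃`, extend `α` to an absolute, resp. weakly absolute,
Hodge class `β` on a smooth completion `𝒳̄` defined over `ℚ̄` by Deligne's global invariant cycle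
theorem and a polarisation argument, and apply the hypothesis to `(𝒳̄, β)`), over the tree's REAL
carriers:

* "`X` defined over `ℚ̄`" (for the fixed embedding `ι : ℚ̄ →+* ℂ`, `ℚ̄ = AlgebraicClosure ℚ`):
  `X = X₀ ×_{ℚ̄, ι} ℂ = (Motives.baseChangeHom ι).obj X₀`, `X₀ : Motives.SchemeOver (AlgebraicClosure ℚ)`
  — the shape of the route statement `Summit.HodgeConjecture.HodgeConjecture.Theses.PeriodsPolice.QbarDescent`;
* "smooth projective (complex) variety": `Motives.IsSmoothProjective n X` (smooth of dimension `n`,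
  projective, geometrically irreducible — the varieties `𝒳̄` of the proof are irreducible);
* "(weakly) absolute Hodge class": `IsAbsoluteHodgeClass n X p c` / `IsWeaklyAbsoluteHodgeClass n X p c`
  on `c ∈ H²ᵖ(X(ℂ); ℂ) = complexBetti X (2p)` (`AbsoluteHodgeClasses.lean`: Voisin's Def. 1.1 /
  Def. 2.1 in the de Rham formulation of Charles–Schnell Def. 11.2.3, each conjugate read through a
  conjugation chart);
* "the Hodge conjecture is true for the class `c`": `c ∈ algebraicClasses X p` (the conclusion of
  `HodgeConjectureFor`, `HodgeConjecture.lean`).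

The hypothesis is stated for ONE fixed embedding `ι` (as printed, Rem. 1.4), which makes the facts
imply the variants with the hypothesis for all embeddings; the corollary in the form requested by the
`ℚ̄`-anchored routes — full Hodge conjecture for all `X₀ ×_σ ℂ` ⟹ Hodge conjecture for weakly
absolute classes — is PROVED from the fact (`hodgeConjecture_weaklyAbsolute_of_hodgeConjectureFor_qbar`:
a weakly absolute class is a rational `(p,p)` class, and an embedding `ℚ̄ →+* ℂ` exists,
`IsAlgClosed.lift`).

## What is NOT here (and why)

Voisin's Thm. 1.5 (criterion: if an irreducible component `S` of the locus of Hodge classes through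
a primitive Hodge class `α` of a fibre of a family `π : 𝒳 → T` defined over `ℚ` carries no constant
sub-variation of Hodge structure of `R^{2k}π_{S*}ℚ_prim` but `ℚα_t`, then `α` is weakly absolute;
variant 2) with constant sub-VHS of type `(k,k)`: `p(S_red)` is defined over `ℚ̄` with Galois-stable
translates), Cor. 1.6, Prop. 1.7 and Thm. 2.3 / Lemma 2.4 are not vendored: they need the locus of
Hodge classes as an ANALYTIC SPACE with its irreducible components and reduced structure `S_red`
(the tree's `HodgeLocus.lean` has the topological locus `locusOfHodgeClasses`, its CONNECTED
components `HodgeLocusComponent` and `IsDefinedOverQbar`, but no analytic-space structure), the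
variation of Hodge structure `R^{2k}π_{S*}ℚ_prim` over `S_red` with the notion of a CONSTANT
sub-variation (the tree's `Motives.VHSData` / `GeometricVHSData` are hypothesis structures without
sub-objects), and primitive cohomology of the fibres. No proof of Prop. 1.2 (spreading out, the
global invariant cycle theorem and the polarisation argument are not in the tree).

## References

* C. Voisin, *Hodge loci and absolute Hodge classes*, Compositio Math. 143 (2007) 945–958,
  arXiv:math/0605766: Def. 1.1, Prop. 1.2, Rem. 1.3–1.4 (p. 2), Def. 2.1, Rem. 2.2 (p. 4), §3 proof
  of Prop. 1.2 (p. 6). [Voisin2007HodgeLoci]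
* F. Charles, C. Schnell, *Notes on absolute Hodge classes* (2014), §11.2.5 (the same statement
  for absolute Hodge classes, Thm. 11.2.6-type discussion). [CharlesSchnell2014Notes]
-/

noncomputable section

open CategoryTheory

namespace Literature.AlgebraicGeometry.HodgeTheory

section HodgeTheory

/-- **Voisin 2007, Prop. 1.2 (absolute Hodge reading).** *"Assume the Hodge conjecture is known for
varieties `X_ℚ̄` defined over `ℚ̄` and absolute Hodge classes `α` on them. Then the Hodge conjecture
is true for absolute Hodge classes"* — for a fixed embedding `ι : ℚ̄ →+* ℂ` (Rem. 1.4): if for every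
smooth projective `X₀ ×_{ℚ̄,ι} ℂ` every absolute Hodge class in `H²ᵖ` is algebraic, then on every
smooth projective complex variety every absolute Hodge class is algebraic (i.e. lies in
`algebraicClasses X p`). [cite: Voisin2007HodgeLoci, Prop. 1.2 and Rem. 1.4] -/
def voisin2007_hodgeConjecture_absolute_of_qbar : Prop :=
  ∀ ι : AlgebraicClosure ℚ →+* ℂ,
    (∀ ⦃n : ℕ⦄ ⦃X₀ : Motives.SchemeOver (AlgebraicClosure ℚ)⦄,
        Motives.IsSmoothProjective n ((Motives.baseChangeHom ι).obj X₀) →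
          ∀ (p : ℕ) (c : complexBetti ((Motives.baseChangeHom ι).obj X₀) (2 * p)),
            IsAbsoluteHodgeClass n ((Motives.baseChangeHom ι).obj X₀) p c →
              c ∈ algebraicClasses ((Motives.baseChangeHom ι).obj X₀) p) →
      ∀ ⦃n : ℕ⦄ ⦃X : Motives.SchemeOver ℂ⦄, Motives.IsSmoothProjective n X →
        ∀ (p : ℕ) (c : complexBetti X (2 * p)), IsAbsoluteHodgeClass n X p c →
          c ∈ algebraicClasses X p

/-- **Voisin 2007, Prop. 1.2 (weakly absolute Hodge reading).** *"Assume the Hodge conjecture is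
known for varieties `X_ℚ̄` defined over `ℚ̄` and weakly absolute Hodge classes `α` on them. Then the
Hodge conjecture is true for weakly absolute Hodge classes"* (weakly absolute: Def. 2.1, each
conjugate `α_σ = λ_σ γ_σ` with `γ_σ` rational, `λ_σ ∈ ℚ̄`; the `ℚ̄`-condition is automatic, Rem. 2.2)
— for a fixed embedding `ι : ℚ̄ →+* ℂ` (Rem. 1.4): if for every smooth projective `X₀ ×_{ℚ̄,ι} ℂ`
every weakly absolute Hodge class is algebraic, then on every smooth projective complex variety
every weakly absolute Hodge class is algebraic. This is the "weak-absoluteness strength" of the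
`ℚ̄`-descent step of the `ℚ̄`-anchored Hodge routes. [cite: Voisin2007HodgeLoci, Prop. 1.2, Rem. 1.4 and Def. 2.1] -/
def voisin2007_hodgeConjecture_weaklyAbsolute_of_qbar : Prop :=
  ∀ ι : AlgebraicClosure ℚ →+* ℂ,
    (∀ ⦃n : ℕ⦄ ⦃X₀ : Motives.SchemeOver (AlgebraicClosure ℚ)⦄,
        Motives.IsSmoothProjective n ((Motives.baseChangeHom ι).obj X₀) →
          ∀ (p : ℕ) (c : complexBetti ((Motives.baseChangeHom ι).obj X₀) (2 * p)),
            IsWeaklyAbsoluteHodgeClass n ((Motives.baseChangeHom ι).obj X₀) p c →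
              c ∈ algebraicClasses ((Motives.baseChangeHom ι).obj X₀) p) →
      ∀ ⦃n : ℕ⦄ ⦃X : Motives.SchemeOver ℂ⦄, Motives.IsSmoothProjective n X →
        ∀ (p : ℕ) (c : complexBetti X (2 * p)), IsWeaklyAbsoluteHodgeClass n X p c →
          c ∈ algebraicClasses X p

/-- There is a field embedding `ℚ̄ →+* ℂ` (`ℂ` is algebraically closed and `ℚ̄/ℚ` algebraic:
Mathlib's `IsAlgClosed.lift`). [folklore] -/
theorem exists_ringHom_algebraicClosure_rat_complex : Nonempty (AlgebraicClosure ℚ →+* ℂ) := by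
  haveI : Algebra.IsAlgebraic ℚ (AlgebraicClosure ℚ) := AlgebraicClosure.isAlgebraic ℚ
  exact ⟨(IsAlgClosed.lift (R := ℚ) (M := ℂ) (S := AlgebraicClosure ℚ)).toRingHom⟩

/-- The Hodge conjecture for a variety gives it for the weakly absolute Hodge classes on it (they
are rational `(p,p)` classes). [cite: Voisin2007HodgeLoci, Def. 2.1] -/
theorem mem_algebraicClasses_of_hodgeConjectureFor_of_isWeaklyAbsoluteHodgeClass {n : ℕ}
    {X : Motives.SchemeOver ℂ} (h : HodgeConjectureFor n X) {p : ℕ} {c : complexBetti X (2 * p)}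
    (hc : IsWeaklyAbsoluteHodgeClass n X p c) : c ∈ algebraicClasses X p :=
  h.2 p c hc.1 hc.2.1

/-- The Hodge conjecture for a variety gives it for the absolute Hodge classes on it.
[cite: Voisin2007HodgeLoci, Def. 1.1] -/
theorem mem_algebraicClasses_of_hodgeConjectureFor_of_isAbsoluteHodgeClass {n : ℕ}
    {X : Motives.SchemeOver ℂ} (h : HodgeConjectureFor n X) {p : ℕ} {c : complexBetti X (2 * p)}
    (hc : IsAbsoluteHodgeClass n X p c) : c ∈ algebraicClasses X p :=
  h.2 p c hc.1 hc.2.1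

/-- **Corollary in the routes' shape** (`ℚ̄`-descent for weakly absolute classes): if the Hodge
conjecture holds for every smooth projective complex variety of the form `X₀ ×_{ℚ̄,σ} ℂ` (all
embeddings `σ`; one suffices), then every weakly absolute Hodge class on every smooth projective
complex variety is algebraic — Voisin's Prop. 1.2 with its hypothesis strengthened from "weakly
absolute classes over `ℚ̄`" to "all Hodge classes over `ℚ̄`". [cite: Voisin2007HodgeLoci, Prop. 1.2] -/
theorem hodgeConjecture_weaklyAbsolute_of_hodgeConjectureFor_qbar
    (hV : voisin2007_hodgeConjecture_weaklyAbsolute_of_qbar)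
    (hQ : ∀ (σ : AlgebraicClosure ℚ →+* ℂ) ⦃n : ℕ⦄ ⦃X₀ : Motives.SchemeOver (AlgebraicClosure ℚ)⦄,
      Motives.IsSmoothProjective n ((Motives.baseChangeHom σ).obj X₀) →
        HodgeConjectureFor n ((Motives.baseChangeHom σ).obj X₀))
    {n : ℕ} {X : Motives.SchemeOver ℂ} (hX : Motives.IsSmoothProjective n X) {p : ℕ}
    {c : complexBetti X (2 * p)} (hc : IsWeaklyAbsoluteHodgeClass n X p c) :
    c ∈ algebraicClasses X p := by
  obtain ⟨ι⟩ := exists_ringHom_algebraicClosure_rat_complex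
  exact hV ι (fun m X₀ hX₀ q d hd ↦
    mem_algebraicClasses_of_hodgeConjectureFor_of_isWeaklyAbsoluteHodgeClass (hQ ι hX₀) hd) hX p c hc

/-- The same corollary for absolute Hodge classes. [cite: Voisin2007HodgeLoci, Prop. 1.2] -/
theorem hodgeConjecture_absolute_of_hodgeConjectureFor_qbar
    (hV : voisin2007_hodgeConjecture_absolute_of_qbar)
    (hQ : ∀ (σ : AlgebraicClosure ℚ →+* ℂ) ⦃n : ℕ⦄ ⦃X₀ : Motives.SchemeOver (AlgebraicClosure ℚ)⦄,
      Motives.IsSmoothProjective n ((Motives.baseChangeHom σ).obj X₀) →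
        HodgeConjectureFor n ((Motives.baseChangeHom σ).obj X₀))
    {n : ℕ} {X : Motives.SchemeOver ℂ} (hX : Motives.IsSmoothProjective n X) {p : ℕ}
    {c : complexBetti X (2 * p)} (hc : IsAbsoluteHodgeClass n X p c) :
    c ∈ algebraicClasses X p := by
  obtain ⟨ι⟩ := exists_ringHom_algebraicClosure_rat_complex
  exact hV ι (fun m X₀ hX₀ q d hd ↦
    mem_algebraicClasses_of_hodgeConjectureFor_of_isAbsoluteHodgeClass (hQ ι hX₀) hd) hX p c hc

end HodgeTheory

end Literature.AlgebraicGeometry.HodgeTheory
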